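import Summits.BirchSwinnertonDyer.Rank1Residual.P2.CongruentNumberEvenPairAokiSymbols
import Summits.BirchSwinnertonDyer.Rank1Residual.P2.CongruentNumberSilentEvenFiveSelmerEightAoki
import Summits.BirchSwinnertonDyer.Rank1Residual.P2.CongruentNumberPairsAtTwoEvenPairTable
import HarnessLib

/-!
# Cell `bsd-monsky`: Aoki's Theorem 2.2 evaluated on the `p ≡ 1 (mod 8)` cells `n = 2pq ≡ 6 (mod 8)` of the
# `k = 2` rung — `#Sel₂(E_{2pq}) = 8` for `(p/q) = −1`, `32` for `(p/q) = +1` (nothing asserted)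

HONEST FRAMING (cell `bsd-monsky`, run/shared/lean/pub/bsd-monsky/, README §1: ONE theorem on ONE explicit
infinite family of quadratic twists of the congruent number curve at the prime `2`; not "BSD for rank ≤ 1",
nothing at odd primes, nothing booked until the cross-family referee passes the written proof). This file
asserts NO arithmetic fact. It evaluates, in the kernel, the named fact `Aoki1999.thm22_card_selmerGroup_two`
(`hAo`, refereed and completely proved in print) on the cells `n = 2pq` with `p ≡ 1 (mod 8)`, `q ≡ 3 (mod 4)`
— the residue class of the `k = 2` rung NOT covered by `P2/CongruentNumberSilentEvenFiveSelmerEightAoki.lean`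
(`p ≡ 5 (mod 8)`):

* §1 `|S| = 3`, `|T| = 1` on every cell (`p ≡ 1 (mod 4)`); for `p ≡ 1 (mod 8)` the column
  `(λ_p(2), λ_p(p), λ_p(q)) = (0, [(q/p) = −1], [(q/p) = −1])`, so `rank Λ_{S,T} = 1` if `(p/q) = −1` and `0`
  if `(p/q) = +1`; the Gram matrix of `( , )_V` on `v_{S₁}(Sel₀)` vanishes in both cases (`(p/q) = −1`: the
  essential vectors are `(a, a)` and `(p,p)_V + 2(p,q)_V + (q,q)_V = 1 + 0 + 1 = 0`; `(p/q) = +1`: all four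
  entries vanish): **`dim Sel^(2) = 3` resp. `5`, i.e. `#Sel₂(E_{2pq}) = 8` resp. `32`**
  (`card_selmerGroup_two_two_mul_one_mul_of_aoki_of_jacobiSym_neg_one` / `…_of_jacobiSym_one`).
* The comparison with Monsky's matrix (`s(2pq) = 1` on these cells for `(p/q) = −1`, `3` for `(p/q) = +1`) and
  the resulting **Aoki = Monsky at `k = 2`** (`selmerDimFormula (2pq) = s(2pq) + 2` on every `k = 2` cell, so the
  `k = 2` instance of `hMe` follows from `hAo`) are the sequel `P2/CongruentNumberEvenPairAokiMonsky.lean`.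

References: [Aoki1999] Thm. 2.2 p. 81, proof p. 98, Thm. 4.1 p. 87; [HeathBrown1994SelmerCongruentII] Appendix
(Monsky), typescript p. 41 L20–L36; [SilvermanAEC2009] Thm. X.4.2.
-/

noncomputable section

open scoped Classical

open WeierstrassCurve Literature.NumberTheory.EllipticCurves
  Literature.NumberTheory.EllipticCurves.Aoki1999
  Literature.NumberTheory.EllipticCurves.Rank1Residual
  Literature.NumberTheory.EllipticCurves.Rank1Residual.Typed
  Literature.NumberTheory.EllipticCurves.HeathBrown1994
  Literature.NumberTheory.EllipticCurves.HeathBrown1994.Families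
  Literature.NumberTheory.EllipticCurves.Monsky1990
  Literature.NumberTheory.QuadraticForms

set_option autoImplicit false

namespace Summit.BirchSwinnertonDyer.Rank1Residual.P2

open Conjectures Literature.NumberTheory.EllipticCurves.Tian2014

/-! ## §1 The evaluation of Theorem 2.2 on `n = 2pq`, `p ≡ 1 (mod 8)`, `q ≡ 3 (mod 4)` -/

section Evaluation

variable {p q : ℕ}

/-- `p ∈ S`. [cite: Aoki1999, §2 p. 80] -/
theorem prime_mem_sSet_pair (hp : p.Prime) (hq : q.Prime) : p ∈ sSet (2 * (p * q)) := by
  rw [sSet_two_mul_five_mul hp hq]; simp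

/-- `q ∈ S`. [cite: Aoki1999, §2 p. 80] -/
theorem other_mem_sSet_pair (hp : p.Prime) (hq : q.Prime) : q ∈ sSet (2 * (p * q)) := by
  rw [sSet_two_mul_five_mul hp hq]; simp

/-- `p ∈ T`. [cite: Aoki1999, §2 p. 80] -/
theorem prime_mem_tSet_pair (hp : p.Prime) (hq : q.Prime) (hp4 : p % 4 = 1) (hq4 : q % 4 = 3) :
    p ∈ tSet (2 * (p * q)) := by
  rw [tSet_two_mul_pair hp hq hp4 hq4]; simp

/-- `p ∈ S₁`. [cite: Aoki1999, §2 p. 80] -/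
theorem prime_mem_sOneSet_pair (hp : p.Prime) (hq : q.Prime) (hp4 : p % 4 = 1) (hq4 : q % 4 = 3) :
    p ∈ sOneSet (2 * (p * q)) := by
  rw [sOneSet_two_mul_pair hp hq hp4 hq4]; simp

/-- `q ∈ S₁`. [cite: Aoki1999, §2 p. 80] -/
theorem other_mem_sOneSet_pair (hp : p.Prime) (hq : q.Prime) (hp4 : p % 4 = 1) (hq4 : q % 4 = 3) :
    q ∈ sOneSet (2 * (p * q)) := by
  rw [sOneSet_two_mul_pair hp hq hp4 hq4]; simp

/-- `q ∈ S₂`. [cite: Aoki1999, Thm. 2.2 p. 81] -/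
theorem other_mem_sTwoSet_pair (hp : p.Prime) (hq : q.Prime) (hp4 : p % 4 = 1) (hq4 : q % 4 = 3) :
    q ∈ sTwoSet (2 * (p * q)) := by
  rw [sTwoSet_two_mul_pair hp hq hp4 hq4]; simp

/-- `|S| = 3`. [cite: Aoki1999, §2 p. 80] -/
theorem card_sSet_two_mul_pair (hp : p.Prime) (hq : q.Prime) (hp4 : p % 4 = 1) (hq4 : q % 4 = 3) :
    (sSet (2 * (p * q))).card = 3 := by
  rw [sSet_two_mul_five_mul hp hq, Finset.card_insert_of_notMem, Finset.card_pair (by omega)]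
  simp only [Finset.mem_insert, Finset.mem_singleton, not_or]
  omega

/-- `|T| = 1`. [cite: Aoki1999, §2 p. 80] -/
theorem card_tSet_two_mul_pair (hp : p.Prime) (hq : q.Prime) (hp4 : p % 4 = 1) (hq4 : q % 4 = 3) :
    (tSet (2 * (p * q))).card = 1 := by
  rw [tSet_two_mul_pair hp hq hp4 hq4, Finset.card_singleton]

/-- A sum over the two-element index type `↥S₁ = {p, q}`. [folklore] -/
theorem sum_sOneSet_eq_pair (hp : p.Prime) (hq : q.Prime) (hp4 : p % 4 = 1) (hq4 : q % 4 = 3)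
    (f : sOneSet (2 * (p * q)) → ZMod 2) :
    ∑ x, f x = f ⟨p, prime_mem_sOneSet_pair hp hq hp4 hq4⟩ + f ⟨q, other_mem_sOneSet_pair hp hq hp4 hq4⟩ := by
  apply Fintype.sum_eq_add
  · intro h
    have := congrArg Subtype.val h
    simp only at this
    omega
  · rintro ⟨x, hx⟩ ⟨h1, h2⟩
    exfalso
    rw [sOneSet_two_mul_pair hp hq hp4 hq4, Finset.mem_insert, Finset.mem_singleton] at hx
    rcases hx with rfl | rfl
    · exact h1 rfl
    · exact h2 rfl

/-- A sum over the one-element index type `↥S₂ = {q}`. [folklore] -/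
theorem sum_sTwoSet_eq_pair (hp : p.Prime) (hq : q.Prime) (hp4 : p % 4 = 1) (hq4 : q % 4 = 3)
    (f : sTwoSet (2 * (p * q)) → ZMod 2) :
    ∑ x, f x = f ⟨q, other_mem_sTwoSet_pair hp hq hp4 hq4⟩ := by
  apply Fintype.sum_eq_single
  rintro ⟨x, hx⟩ h1
  exfalso
  rw [sTwoSet_two_mul_pair hp hq hp4 hq4, Finset.mem_singleton] at hx
  subst hx
  exact h1 rfl

/-- Membership in `v_{S₁}(Sel₀)` gives the linear condition `w_p λ_p(p) + w_q λ_p(q) = 0` (`λ_p(x_w) = 0`,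
`p ∈ T`). [cite: Aoki1999, Thm. 4.1 p. 87] -/
theorem essential_condition_pair (hp : p.Prime) (hq : q.Prime) (hp4 : p % 4 = 1) (hq4 : q % 4 = 3)
    (w : essential (2 * (p * q))) :
    (w : sOneSet (2 * (p * q)) → ZMod 2) ⟨p, prime_mem_sOneSet_pair hp hq hp4 hq4⟩ *
        lam (2 * (p * q)) p p +
      (w : sOneSet (2 * (p * q)) → ZMod 2) ⟨q, other_mem_sOneSet_pair hp hq hp4 hq4⟩ *
        lam (2 * (p * q)) p q = 0 := by
  have hw := (Finset.mem_filter.mp w.2).2.1 p (prime_mem_tSet_pair hp hq hp4 hq4)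
  have hn : 2 * (p * q) ≠ 0 := mul_ne_zero two_ne_zero (mul_ne_zero hp.ne_zero hq.ne_zero)
  rw [lam_rep hn, sum_sOneSet_eq_pair hp hq hp4 hq4] at hw
  exact hw

/-- `ν(2pq) = 1` (`n` even). [cite: Aoki1999, Thm. 2.2 p. 81] -/
theorem nu_two_mul_pair : nu (2 * (p * q)) = 1 := by
  unfold nu; rw [if_pos (by omega)]

/-- `ε₂(p) = 0` for `p ≡ 1 (mod 4)`. [cite: Aoki1999, Thm. 2.2 p. 81] -/
theorem epsTwo_of_one_mod_four (hp4 : p % 4 = 1) : epsTwo p = 0 := by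
  unfold epsTwo; rw [if_pos hp4]

/-- `ε₂(q) = 1` for `q ≡ 3 (mod 4)`. [cite: Aoki1999, Thm. 2.2 p. 81] -/
theorem epsTwo_of_three_mod_four (hq4 : q % 4 = 3) : epsTwo q = 1 := by
  unfold epsTwo; rw [if_neg (by omega)]

/-- The diagonal Gram entry at `p`, `p ≡ 1 (mod 8)`: `(p, p)_V = λ_q(p)² + λ₂(p) = λ_q(p)`.
[cite: Aoki1999, proof of Thm. 2.2 p. 98] -/
theorem gramMatrix_prime_prime_one (hp : p.Prime) (hq : q.Prime) (hp1 : p % 8 = 1) (hq4 : q % 4 = 3) :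
    gramMatrix (2 * (p * q)) ⟨p, prime_mem_sOneSet_pair hp hq (by omega) hq4⟩
      ⟨p, prime_mem_sOneSet_pair hp hq (by omega) hq4⟩ = lam (2 * (p * q)) q p := by
  simp only [gramMatrix, Matrix.of_apply, if_true, sum_sTwoSet_eq_pair hp hq (by omega) hq4,
    lam_two_prime_one hp hp1]
  have hsq : ∀ x : ZMod 2, x * x = x := by decide
  rw [hsq]
  simp

/-- The diagonal Gram entry at `q`: `(q, q)_V = λ_q(q)² + λ₂(q) = λ_q(q) + λ₂(q)` (`p ≡ 1 (mod 4)`).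
[cite: Aoki1999, proof of Thm. 2.2 p. 98] -/
theorem gramMatrix_other_other_pair (hp : p.Prime) (hq : q.Prime) (hp4 : p % 4 = 1) (hq4 : q % 4 = 3) :
    gramMatrix (2 * (p * q)) ⟨q, other_mem_sOneSet_pair hp hq hp4 hq4⟩
      ⟨q, other_mem_sOneSet_pair hp hq hp4 hq4⟩ = lam (2 * (p * q)) q q + lam (2 * (p * q)) 2 q := by
  simp only [gramMatrix, Matrix.of_apply, if_true, sum_sTwoSet_eq_pair hp hq hp4 hq4]
  have hsq : ∀ x : ZMod 2, x * x = x := by decide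
  have hcomm : ∀ a b : ZMod 2, a * b + b * a = 0 := by decide
  rw [hsq, hcomm, mul_zero, add_zero]

/-- The off-diagonal Gram entry `(p, q)_V = λ_q(p)λ_q(q) + ν(λ₂(p)ε₂(q) + ε₂(p)λ₂(q)) = λ_q(p)λ_q(q)` for
`p ≡ 1 (mod 8)` (`λ₂(p) = 0`, `ε₂(p) = 0`). [cite: Aoki1999, proof of Thm. 2.2 p. 98] -/
theorem gramMatrix_prime_other_one (hp : p.Prime) (hq : q.Prime) (hp1 : p % 8 = 1) (hq4 : q % 4 = 3) :
    gramMatrix (2 * (p * q)) ⟨p, prime_mem_sOneSet_pair hp hq (by omega) hq4⟩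
      ⟨q, other_mem_sOneSet_pair hp hq (by omega) hq4⟩ =
      lam (2 * (p * q)) q p * lam (2 * (p * q)) q q := by
  have hne : (⟨p, prime_mem_sOneSet_pair hp hq (by omega) hq4⟩ : sOneSet (2 * (p * q))) ≠
      ⟨q, other_mem_sOneSet_pair hp hq (by omega) hq4⟩ := by
    intro h
    have := congrArg Subtype.val h
    simp only at this
    omega
  simp only [gramMatrix, Matrix.of_apply, if_neg hne, sum_sTwoSet_eq_pair hp hq (by omega) hq4,
    lam_two_prime_one hp hp1, epsTwo_of_one_mod_four (show p % 4 = 1 by omega), nu_two_mul_pair]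
  ring

/-- The off-diagonal Gram entry `(q, p)_V = λ_q(q)λ_q(p)` for `p ≡ 1 (mod 8)`. [cite: Aoki1999, proof of Thm. 2.2 p. 98] -/
theorem gramMatrix_other_prime_one (hp : p.Prime) (hq : q.Prime) (hp1 : p % 8 = 1) (hq4 : q % 4 = 3) :
    gramMatrix (2 * (p * q)) ⟨q, other_mem_sOneSet_pair hp hq (by omega) hq4⟩
      ⟨p, prime_mem_sOneSet_pair hp hq (by omega) hq4⟩ =
      lam (2 * (p * q)) q q * lam (2 * (p * q)) q p := by
  have hne : (⟨q, other_mem_sOneSet_pair hp hq (by omega) hq4⟩ : sOneSet (2 * (p * q))) ≠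
      ⟨p, prime_mem_sOneSet_pair hp hq (by omega) hq4⟩ := by
    intro h
    have := congrArg Subtype.val h
    simp only at this
    omega
  simp only [gramMatrix, Matrix.of_apply, if_neg hne, sum_sTwoSet_eq_pair hp hq (by omega) hq4,
    lam_two_prime_one hp hp1, epsTwo_of_one_mod_four (show p % 4 = 1 by omega), nu_two_mul_pair]
  ring

end Evaluation

/-! ## §2 The two Legendre halves of the `p ≡ 1 (mod 8)` cells: `rank Λ_{S,T}`, the Gram matrix, the dimension -/

section Cases

variable {p q : ℕ}

/-- **`rank Λ_{S,T} = 1` for `p ≡ 1 (mod 8)`, `(q/p) = −1`**: `T = {p}` and the entry `λ_p(p) = 1` is non-zero.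
[cite: Aoki1999, Thm. 2.1 p. 80] -/
theorem rank_lamMatrix_one_of_jacobiSym_neg_one (hp : p.Prime) (hq : q.Prime) (hp1 : p % 8 = 1)
    (hq4 : q % 4 = 3) (hj : jacobiSym q p = -1) :
    (lamMatrix (2 * (p * q)) (sSet (2 * (p * q))) (tSet (2 * (p * q)))).rank = 1 := by
  refine rank_eq_one_of_card_eq_one _ ?_ (i := ⟨p, prime_mem_sSet_pair hp hq⟩)
    (j := ⟨p, prime_mem_tSet_pair hp hq (by omega) hq4⟩) ?_
  · rw [Fintype.card_coe, card_tSet_two_mul_pair hp hq (by omega) hq4]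
  · show lam (2 * (p * q)) p ((p : ℕ) : ℤ) ≠ 0
    rw [Ne, lam_prime_prime_eq_zero_iff' hp hq hp1 hq4, hj]
    decide

/-- **The Gram matrix of `( , )_V` on `v_{S₁}(Sel₀)` vanishes for `p ≡ 1 (mod 8)`, `(q/p) = −1`**: every
essential `w` has `w_p = w_q` (`λ_p(p) = λ_p(q) = 1`), and `(p,p)_V + (p,q)_V + (q,p)_V + (q,q)_V =
λ_q(p) + 2λ_q(p)λ_q(q) + λ_q(q) + λ₂(q) = 1 + 0 + (λ₂(q) + 1) + λ₂(q) = 0`.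
[cite: Aoki1999, proof of Thm. 2.2 p. 98, Lemma 7.3 pp. 98–99] -/
theorem gramEssential_one_of_jacobiSym_neg_one (hp : p.Prime) (hq : q.Prime) (hp1 : p % 8 = 1)
    (hq4 : q % 4 = 3) (hj : jacobiSym q p = -1) : gramEssential (2 * (p * q)) = 0 := by
  have hp4 : p % 4 = 1 := by omega
  have hrec : jacobiSym q p = jacobiSym p q :=
    jacobiSym.quadratic_reciprocity_one_mod_four' (hq.odd_of_ne_two (by omega)) hp4
  have hzo : ∀ x : ZMod 2, x ≠ 0 → x = 1 := by decide
  have hpp : lam (2 * (p * q)) p p = 1 := hzo _ (by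
    rw [Ne, lam_prime_prime_eq_zero_iff' hp hq hp1 hq4, hj]; decide)
  have hpq : lam (2 * (p * q)) p q = 1 := hzo _ (by
    rw [Ne, lam_prime_other_eq_zero_iff' hp hq hp4 hq4, hj]; decide)
  have hqp : lam (2 * (p * q)) q p = 1 := hzo _ (by
    rw [Ne, lam_other_prime_eq_zero_iff' hp hq hp4 hq4, ← hrec, hj]; decide)
  have hqq : lam (2 * (p * q)) q q = lam (2 * (p * q)) 2 q + 1 :=
    lam_other_other_eq_lam_two_add_one hp hq hp4 hq4 (hrec ▸ hj)
  set P : sOneSet (2 * (p * q)) := ⟨p, prime_mem_sOneSet_pair hp hq hp4 hq4⟩ with hP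
  set Q : sOneSet (2 * (p * q)) := ⟨q, other_mem_sOneSet_pair hp hq hp4 hq4⟩ with hQ
  -- every essential vector has `w_p = w_q`
  have key : ∀ v : essential (2 * (p * q)),
      (v : sOneSet (2 * (p * q)) → ZMod 2) Q = (v : sOneSet (2 * (p * q)) → ZMod 2) P := by
    intro v
    have := essential_condition_pair hp hq hp4 hq4 v
    rw [hpp, hpq, mul_one, mul_one] at this
    have hsum : ∀ a b : ZMod 2, a + b = 0 → b = a := by decide
    exact hsum _ _ this
  -- the four entries sum to zero
  have hsum : gramMatrix (2 * (p * q)) P P + gramMatrix (2 * (p * q)) P Q +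
      gramMatrix (2 * (p * q)) Q P + gramMatrix (2 * (p * q)) Q Q = 0 := by
    rw [hP, hQ, gramMatrix_prime_prime_one hp hq hp1 hq4, gramMatrix_prime_other_one hp hq hp1 hq4,
      gramMatrix_other_prime_one hp hq hp1 hq4, gramMatrix_other_other_pair hp hq hp4 hq4, hqp, hqq]
    generalize lam (2 * (p * q)) 2 q = c
    revert c; decide
  ext w w'
  simp only [gramEssential, Matrix.of_apply, Matrix.zero_apply, Matrix.mulVec, dotProduct,
    sum_sOneSet_eq_pair hp hq hp4 hq4]
  rw [key w, key w']
  calc (w : sOneSet (2 * (p * q)) → ZMod 2) P *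
        (gramMatrix (2 * (p * q)) P P * (w' : sOneSet (2 * (p * q)) → ZMod 2) P +
          gramMatrix (2 * (p * q)) P Q * (w' : sOneSet (2 * (p * q)) → ZMod 2) P) +
      (w : sOneSet (2 * (p * q)) → ZMod 2) P *
        (gramMatrix (2 * (p * q)) Q P * (w' : sOneSet (2 * (p * q)) → ZMod 2) P +
          gramMatrix (2 * (p * q)) Q Q * (w' : sOneSet (2 * (p * q)) → ZMod 2) P) =
      (w : sOneSet (2 * (p * q)) → ZMod 2) P * (w' : sOneSet (2 * (p * q)) → ZMod 2) P *
        (gramMatrix (2 * (p * q)) P P + gramMatrix (2 * (p * q)) P Q +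
          gramMatrix (2 * (p * q)) Q P + gramMatrix (2 * (p * q)) Q Q) := by ring
    _ = 0 := by rw [hsum, mul_zero]

/-- **Theorem 2.2 on the cells `p ≡ 1 (mod 8)`, `(q/p) = −1`: `dim Sel^(2) = 1 + 3 + 1 − 2 − 0 = 3`.**
[cite: Aoki1999, Thm. 2.2 p. 81] -/
theorem selmerDimFormula_one_of_jacobiSym_neg_one (hp : p.Prime) (hq : q.Prime) (hp1 : p % 8 = 1)
    (hq4 : q % 4 = 3) (hj : jacobiSym q p = -1) : selmerDimFormula (2 * (p * q)) = 3 := by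
  unfold selmerDimFormula
  rw [card_sSet_two_mul_pair hp hq (by omega) hq4, card_tSet_two_mul_pair hp hq (by omega) hq4,
    rank_lamMatrix_one_of_jacobiSym_neg_one hp hq hp1 hq4 hj,
    gramEssential_one_of_jacobiSym_neg_one hp hq hp1 hq4 hj, Matrix.rank_zero]
  norm_num

/-- **`Λ_{S,T} = 0` for `p ≡ 1 (mod 8)`, `(q/p) = +1`**: `λ_p(2) = λ_p(p) = λ_p(q) = 0`.
[cite: Aoki1999, Thm. 2.1 p. 80] -/
theorem lamMatrix_one_of_jacobiSym_one (hp : p.Prime) (hq : q.Prime) (hp1 : p % 8 = 1)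
    (hq4 : q % 4 = 3) (hj : jacobiSym q p = 1) :
    lamMatrix (2 * (p * q)) (sSet (2 * (p * q))) (tSet (2 * (p * q))) = 0 := by
  have hp4 : p % 4 = 1 := by omega
  ext ⟨i, hi⟩ ⟨j, hj'⟩
  rw [tSet_two_mul_pair hp hq hp4 hq4, Finset.mem_singleton] at hj'
  subst hj'
  rw [sSet_two_mul_five_mul hp hq, Finset.mem_insert, Finset.mem_insert, Finset.mem_singleton] at hi
  simp only [lamMatrix, Matrix.of_apply, Matrix.zero_apply]
  rcases hi with rfl | rfl | rfl
  · exact_mod_cast lam_prime_two_one hp hq hp1 hq4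
  · exact (lam_prime_prime_eq_zero_iff' hp hq hp1 hq4).mpr hj
  · exact (lam_prime_other_eq_zero_iff' hp hq hp4 hq4).mpr hj

/-- **The Gram matrix vanishes identically for `p ≡ 1 (mod 8)`, `(q/p) = +1`**: `(p,p)_V = λ_q(p) = 0`,
`(q,q)_V = λ_q(q) + λ₂(q) = 0`, `(p,q)_V = (q,p)_V = λ_q(p)λ_q(q) = 0`.
[cite: Aoki1999, proof of Thm. 2.2 p. 98] -/
theorem gramMatrix_one_of_jacobiSym_one (hp : p.Prime) (hq : q.Prime) (hp1 : p % 8 = 1)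
    (hq4 : q % 4 = 3) (hj : jacobiSym q p = 1) : gramMatrix (2 * (p * q)) = 0 := by
  have hp4 : p % 4 = 1 := by omega
  have hrec : jacobiSym q p = jacobiSym p q :=
    jacobiSym.quadratic_reciprocity_one_mod_four' (hq.odd_of_ne_two (by omega)) hp4
  have hqp : lam (2 * (p * q)) q p = 0 := (lam_other_prime_eq_zero_iff' hp hq hp4 hq4).mpr (hrec ▸ hj)
  have hqq : lam (2 * (p * q)) q q = lam (2 * (p * q)) 2 q :=
    lam_other_other_eq_lam_two' hp hq hp4 hq4 (hrec ▸ hj)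
  have hxx : ∀ x : ZMod 2, x + x = 0 := by decide
  ext ⟨i, hi⟩ ⟨j, hj'⟩
  rw [sOneSet_two_mul_pair hp hq hp4 hq4, Finset.mem_insert, Finset.mem_singleton] at hi hj'
  rcases hi with rfl | rfl <;> rcases hj' with rfl | rfl
  · rw [gramMatrix_prime_prime_one hp hq hp1 hq4, hqp]; rfl
  · rw [gramMatrix_prime_other_one hp hq hp1 hq4, hqp, zero_mul]; rfl
  · rw [gramMatrix_other_prime_one hp hq hp1 hq4, hqp, mul_zero]; rfl
  · rw [gramMatrix_other_other_pair hp hq hp4 hq4, hqq, hxx]; rfl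

/-- **Theorem 2.2 on the cells `p ≡ 1 (mod 8)`, `(q/p) = +1`: `dim Sel^(2) = 1 + 3 + 1 − 0 − 0 = 5`.**
[cite: Aoki1999, Thm. 2.2 p. 81] -/
theorem selmerDimFormula_one_of_jacobiSym_one (hp : p.Prime) (hq : q.Prime) (hp1 : p % 8 = 1)
    (hq4 : q % 4 = 3) (hj : jacobiSym q p = 1) : selmerDimFormula (2 * (p * q)) = 5 := by
  have hG : gramEssential (2 * (p * q)) = 0 := by
    ext w w'
    simp only [gramEssential, Matrix.of_apply, Matrix.zero_apply, gramMatrix_one_of_jacobiSym_one hp hq hp1 hq4 hj,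
      Matrix.zero_mulVec, dotProduct_zero]
  unfold selmerDimFormula
  rw [card_sSet_two_mul_pair hp hq (by omega) hq4, card_tSet_two_mul_pair hp hq (by omega) hq4,
    lamMatrix_one_of_jacobiSym_one hp hq hp1 hq4 hj, hG, Matrix.rank_zero, Matrix.rank_zero]
  norm_num

/-- `2pq` is square-free for distinct odd primes. [folklore] -/
theorem squarefree_two_mul_pair (hp : p.Prime) (hq : q.Prime) (hp4 : p % 4 = 1) (hq4 : q % 4 = 3) :
    Squarefree (2 * (p * q)) :=
  squarefree_two_mul_mul_of_primes hp hq (by omega) (by omega) (fun h => by omega)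

/-- **`#Sel₂(E_{2pq}/ℚ) = 8` for `p ≡ 1 (mod 8)`, `q ≡ 3 (mod 4)`, `(q/p) = −1`, from Aoki's Theorem 2.2 alone**
(`hAo`). [cite: Aoki1999, Thm. 2.2 p. 81] -/
theorem card_selmerGroup_two_two_mul_one_mul_of_aoki_of_jacobiSym_neg_one (hAo : thm22_card_selmerGroup_two)
    (hp : p.Prime) (hq : q.Prime) (hp1 : p % 8 = 1) (hq4 : q % 4 = 3) (hj : jacobiSym q p = -1) :
    Nat.card ((congruentNumberCurve (2 * (p * q))).selmerGroup 2) = 8 := by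
  have hsq := squarefree_two_mul_pair hp hq (by omega) hq4
  obtain ⟨d, hd, hd'⟩ := hAo _ (Nat.pos_of_ne_zero hsq.ne_zero) hsq
    (Or.inr (Or.inl (two_mul_pair_mod_eight (by omega) hq4)))
  rw [selmerDimFormula_one_of_jacobiSym_neg_one hp hq hp1 hq4 hj] at hd'
  have h3 : d = 3 := by exact_mod_cast hd'
  rw [hd, h3]
  norm_num

/-- **`#Sel₂(E_{2pq}/ℚ) = 32` for `p ≡ 1 (mod 8)`, `q ≡ 3 (mod 4)`, `(q/p) = +1`, from Aoki's Theorem 2.2 alone**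
(`hAo`) — the `s = 3` cells of the `k = 2` rung. [cite: Aoki1999, Thm. 2.2 p. 81] -/
theorem card_selmerGroup_two_two_mul_one_mul_of_aoki_of_jacobiSym_one (hAo : thm22_card_selmerGroup_two)
    (hp : p.Prime) (hq : q.Prime) (hp1 : p % 8 = 1) (hq4 : q % 4 = 3) (hj : jacobiSym q p = 1) :
    Nat.card ((congruentNumberCurve (2 * (p * q))).selmerGroup 2) = 32 := by
  have hsq := squarefree_two_mul_pair hp hq (by omega) hq4
  obtain ⟨d, hd, hd'⟩ := hAo _ (Nat.pos_of_ne_zero hsq.ne_zero) hsq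
    (Or.inr (Or.inl (two_mul_pair_mod_eight (by omega) hq4)))
  rw [selmerDimFormula_one_of_jacobiSym_one hp hq hp1 hq4 hj] at hd'
  have h5 : d = 5 := by exact_mod_cast hd'
  rw [hd, h5]
  norm_num

end Cases

end Summit.BirchSwinnertonDyer.Rank1Residual.P2

end
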